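import Literature.MathematicalPhysics.QuantumLattice.HubbardHopWeightCounting
import HarnessLib

/-!
# Hole/doublon counting bound on the Hubbard kinetic energy (Nagaoka–Brinkman–Rice form)

Topic `MathematicalPhysics/QuantumLattice` (family `hubbard`); part 2 (part 1: `HubbardHopWeightCounting.lean`).
For the Hubbard Hamiltonian `H = hamiltonian G t U = -t T_G + U Σ_x n_{x↑}n_{x↓}`,
`T_G = Σ_{x∼y,σ} c†_{xσ}c_{yσ} = hoppingForm G 1`, on a finite graph `G` of maximal degree `≤ Δ`, and ANY
Fock vector `φ`, we PROVE the occupation-basis estimate (every `ω > 0`)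

  `|⟨φ, T_G φ⟩| ≤ Σ_s |φ(s)|² · [Δ(|Λ| - |s| + #dbl(s)) + (1 + 2ω⁻¹)Δ #dbl(s) + ωΔ|Λ|]`

(`norm_expect_hoppingForm_le`; `#dbl(s)` = number of doubly occupied sites, `|Λ| - |s| + #dbl(s)` =
number of empty sites). In words: a hop `c†_{xσ}c_{yσ}` connects two configurations of which either one
has a HOLE next to the moving electron (charged `1`), or one has a DOUBLON (charged `ω⁻¹`) and the other
two singly occupied neighbours of opposite spins (charged `ω`); Young's inequality with these weights and
the hop-reversal symmetry `(x,y,σ) ↔ (y,x,σ)` (part 1) reduce the quadratic form to a diagonal one,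
bounded configuration-wise by counting (at most `Δ` bonds per hole / doublon / site;
`norm_expect_hoppingForm_le_of_weights` is the abstract assembly). Consequences:

* `holeCounting_le_re_expect_hamiltonian` — for a unit vector of the `N`-particle sector,
  `Re⟨φ, H φ⟩ ≥ -|t|Δ(|Λ| - N + ω|Λ|) + (U - |t|Δ(2 + 2ω⁻¹)) Re⟨φ, Σ_x n_{x↑}n_{x↓} φ⟩`;
* `holeCounting_le_minEnergyOn_szSector` — for `U ≥ |t|Δ(2 + 2ω⁻¹)` every nonempty joint sector obeys
  `minEnergyOn H (szSector N M) ≥ -|t|Δ(|Λ| - N + ω|Λ|)`: at strong coupling the ground-state energy per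
  site is `≥ -|t|Δ·(hole density) - ω|t|Δ` with `ω = 2|t|Δ/(U - 2|t|Δ) = O(|t|Δ/U)` — the rigorous form
  of the Nagaoka / Brinkman–Rice hole-bandwidth count `-z|t|δ`, uniformly in the volume. On the square
  torus (`Δ = 4`, `t = 1`): `e ≥ -4δ - 4ω` for `U ≥ 8 + 8/ω`, to be compared with the free value
  `e₀(1 - δ) ≤ -16/π² + 4δ`; so the repulsion raises the ground-state energy DENSITY strictly near half
  filling (`HubbardTorusRepulsionGap.lean`).

Everything is proved; no definition and no named fact. [folklore] (Y. Nagaoka, Phys. Rev. 147 (1966) 392,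
§II; W. F. Brinkman, T. M. Rice, Phys. Rev. B 2 (1970) 1324, §II — the `U = ∞` hole bandwidth `z t`; the
doublon-weighted finite-`U` version is elementary).

## Mathlib / tree search

Tree (REUSED): part 1; `hoppingForm_one` (`HubbardGaugeBound`), `hamiltonian` (`HubbardWave0`),
`sum_numberOp_mul_numberOp_eq_diagonal` (`HubbardAtomicLimit`), `mem_szSector_iff` (`HubbardModel`),
`Matrix.minEnergyOn` (`FinDimSpectrum`). Mathlib: `Matrix.sum_mulVec`, `Fintype.sum_prod_type`,
`Equiv.sum_comp`, `Matrix.mulVec_diagonal`, `Complex.conj_mul'`, `Complex.abs_re_le_norm`, `le_csInf`.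
-/

noncomputable section

namespace Literature.MathematicalPhysics.QuantumLattice

open Matrix Finset

variable {Λ : Type*} [LinearOrder Λ] [Fintype Λ]

/-! ### The quadratic form of the hopping operator -/

section Hopping

variable (G : SimpleGraph Λ) [DecidableRel G.Adj]

/-- **Abstract assembly.** If every bond form is controlled by a configuration weight `W` and its
reversal, `|⟨φ,T_bφ⟩| ≤ ½(Σ_s W_b(s)|φ(s)|² + Σ_s W_{b̄}(s)|φ(s)|²)`, and the adjacency-summed weights
are bounded configuration-wise by `β`, then `|⟨φ, T_G φ⟩| ≤ Σ_s |φ(s)|² β(s)` (hop-reversal symmetry of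
the graph and one exchange of summations). [folklore] -/
theorem norm_expect_hoppingForm_le_of_weights (φ : Fock (Orb Λ)) (W : Bond Λ → Finset (Orb Λ) → ℝ)
    (β : Finset (Orb Λ) → ℝ)
    (h1 : ∀ b : Bond Λ, b.1 ≠ b.2.1 → ‖star φ ⬝ᵥ (bondOp b *ᵥ φ)‖ ≤
      (1 / 2) * ((∑ s, W b s * ‖φ s‖ ^ 2) + ∑ s, W (b.2.1, b.1, b.2.2) s * ‖φ s‖ ^ 2))
    (h2 : ∀ s, ∑ x, ∑ y, (if G.Adj x y then ∑ σ : Fin 2, W (x, y, σ) s else 0) ≤ β s) :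
    ‖star φ ⬝ᵥ (hoppingForm G (fun _ _ => 1) *ᵥ φ)‖ ≤ ∑ s, ‖φ s‖ ^ 2 * β s := by
  classical
  -- the form as a sum over bonds
  have hexp : star φ ⬝ᵥ (hoppingForm G (fun _ _ => 1) *ᵥ φ) =
      ∑ b : Bond Λ, if G.Adj b.1 b.2.1 then star φ ⬝ᵥ (bondOp b *ᵥ φ) else 0 := by
    rw [hoppingForm_one]
    simp only [Matrix.sum_mulVec, dotProduct_sum, Fintype.sum_prod_type]
    refine Finset.sum_congr rfl fun x _ => Finset.sum_congr rfl fun y _ =>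
      Finset.sum_congr rfl fun σ _ => ?_
    split_ifs
    · rfl
    · simp
  -- indicator of adjacency on bonds and the bond reversal
  have ha_nonneg : ∀ b : Bond Λ, (0 : ℝ) ≤ (if G.Adj b.1 b.2.1 then (1 : ℝ) else 0) := fun b => by
    split_ifs <;> norm_num
  set rev : Bond Λ ≃ Bond Λ :=
    { toFun := fun b => (b.2.1, b.1, b.2.2)
      invFun := fun b => (b.2.1, b.1, b.2.2)
      left_inv := fun b => rfl
      right_inv := fun b => rfl } with hrev
  have hrev_apply : ∀ b : Bond Λ, rev b = (b.2.1, b.1, b.2.2) := fun b => rfl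
  have ha_rev : ∀ b : Bond Λ, (if G.Adj (rev b).1 (rev b).2.1 then (1 : ℝ) else 0) =
      if G.Adj b.1 b.2.1 then (1 : ℝ) else 0 := fun b => by
    rw [hrev_apply]
    dsimp only
    by_cases h : G.Adj b.1 b.2.1
    · rw [if_pos h, if_pos h.symm]
    · rw [if_neg h, if_neg fun h' => h h'.symm]
  -- (1) triangle inequality
  have step1 : ‖star φ ⬝ᵥ (hoppingForm G (fun _ _ => 1) *ᵥ φ)‖ ≤
      ∑ b : Bond Λ, (if G.Adj b.1 b.2.1 then (1 : ℝ) else 0) * ‖star φ ⬝ᵥ (bondOp b *ᵥ φ)‖ := by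
    rw [hexp]
    refine (norm_sum_le _ _).trans (Finset.sum_le_sum fun b _ => ?_)
    split_ifs <;> simp
  -- (2) bond by bond
  have step2 : ∑ b : Bond Λ, (if G.Adj b.1 b.2.1 then (1 : ℝ) else 0) * ‖star φ ⬝ᵥ (bondOp b *ᵥ φ)‖ ≤
      ∑ b : Bond Λ, (if G.Adj b.1 b.2.1 then (1 : ℝ) else 0) *
        ((1 / 2) * ((∑ s, W b s * ‖φ s‖ ^ 2) + ∑ s, W (rev b) s * ‖φ s‖ ^ 2)) := by
    refine Finset.sum_le_sum fun b _ => ?_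
    by_cases h : G.Adj b.1 b.2.1
    · rw [if_pos h, one_mul, one_mul, hrev_apply]
      exact h1 b (G.ne_of_adj h)
    · rw [if_neg h, zero_mul, zero_mul]
  -- (3) hop reversal: the two halves are equal
  have step3 : ∑ b : Bond Λ, (if G.Adj b.1 b.2.1 then (1 : ℝ) else 0) * ∑ s, W (rev b) s * ‖φ s‖ ^ 2 =
      ∑ b : Bond Λ, (if G.Adj b.1 b.2.1 then (1 : ℝ) else 0) * ∑ s, W b s * ‖φ s‖ ^ 2 := by
    have h := Equiv.sum_comp rev
      (fun b => (if G.Adj b.1 b.2.1 then (1 : ℝ) else 0) * ∑ s, W b s * ‖φ s‖ ^ 2)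
    rw [← h]
    refine Finset.sum_congr rfl fun b _ => ?_
    rw [ha_rev]
  -- (4) exchange of summations
  have step4 : ∑ b : Bond Λ, (if G.Adj b.1 b.2.1 then (1 : ℝ) else 0) * ∑ s, W b s * ‖φ s‖ ^ 2 =
      ∑ s, ‖φ s‖ ^ 2 * ∑ x, ∑ y, (if G.Adj x y then ∑ σ : Fin 2, W (x, y, σ) s else 0) := by
    simp only [Finset.mul_sum]
    rw [Finset.sum_comm]
    refine Finset.sum_congr rfl fun s _ => ?_
    simp only [Fintype.sum_prod_type]
    refine Finset.sum_congr rfl fun x _ => Finset.sum_congr rfl fun y _ => ?_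
    split_ifs
    · rw [Finset.mul_sum]
      refine Finset.sum_congr rfl fun σ _ => ?_
      ring
    · simp
  -- (5) conclude
  calc ‖star φ ⬝ᵥ (hoppingForm G (fun _ _ => 1) *ᵥ φ)‖
      ≤ ∑ b : Bond Λ, (if G.Adj b.1 b.2.1 then (1 : ℝ) else 0) *
          ((1 / 2) * ((∑ s, W b s * ‖φ s‖ ^ 2) + ∑ s, W (rev b) s * ‖φ s‖ ^ 2)) := step1.trans step2
    _ = ∑ b : Bond Λ, (if G.Adj b.1 b.2.1 then (1 : ℝ) else 0) * ∑ s, W b s * ‖φ s‖ ^ 2 := by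
        have hsplit : ∑ b : Bond Λ, (if G.Adj b.1 b.2.1 then (1 : ℝ) else 0) *
            ((1 / 2) * ((∑ s, W b s * ‖φ s‖ ^ 2) + ∑ s, W (rev b) s * ‖φ s‖ ^ 2)) =
            (1 / 2) * (∑ b : Bond Λ, (if G.Adj b.1 b.2.1 then (1 : ℝ) else 0) * ∑ s, W b s * ‖φ s‖ ^ 2) +
            (1 / 2) * (∑ b : Bond Λ, (if G.Adj b.1 b.2.1 then (1 : ℝ) else 0) *
              ∑ s, W (rev b) s * ‖φ s‖ ^ 2) := by
          rw [Finset.mul_sum, Finset.mul_sum, ← Finset.sum_add_distrib]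
          refine Finset.sum_congr rfl fun b _ => ?_
          ring
        rw [hsplit, step3]
        ring
    _ = ∑ s, ‖φ s‖ ^ 2 * ∑ x, ∑ y, (if G.Adj x y then ∑ σ : Fin 2, W (x, y, σ) s else 0) := step4
    _ ≤ ∑ s, ‖φ s‖ ^ 2 * β s :=
        Finset.sum_le_sum fun s _ => mul_le_mul_of_nonneg_left (h2 s) (sq_nonneg _)

/-- **Hole/doublon counting bound on the hopping form.** On a finite graph of maximal degree `≤ Δ`,
for every Fock vector `φ` and every `ω > 0`:
`|⟨φ, T_G φ⟩| ≤ Σ_s |φ(s)|² [Δ(|Λ| - |s| + #dbl(s)) + (1 + 2ω⁻¹)Δ #dbl(s) + ωΔ|Λ|]`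
(`#dbl(s)` = number of doubly occupied sites, `|Λ| - |s| + #dbl(s)` = number of empty sites).
[folklore] -/
theorem norm_expect_hoppingForm_le {Δ : ℕ} (hΔ : ∀ v : Λ, (Finset.univ.filter (G.Adj v)).card ≤ Δ)
    {ω : ℝ} (hω : 0 < ω) (φ : Fock (Orb Λ)) :
    ‖star φ ⬝ᵥ (hoppingForm G (fun _ _ => 1) *ᵥ φ)‖ ≤
      ∑ s, ‖φ s‖ ^ 2 * (Δ * ((Fintype.card Λ : ℝ) - s.card + (doublyOccupied s).card) +
        (1 + 2 * ω⁻¹) * Δ * (doublyOccupied s).card + ω * Δ * Fintype.card Λ) := by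
  refine norm_expect_hoppingForm_le_of_weights G φ
    (fun b s => if orb b.1 b.2.2 ∈ s ∧ orb b.2.1 b.2.2 ∉ s then
      ((if (orb b.2.1 0 ∈ s ∨ orb b.2.1 1 ∈ s) then ω else 1) *
        (if (orb b.1 0 ∈ s ∧ orb b.1 1 ∈ s) then ω⁻¹ else 1)) else 0)
    _ (fun b hb => ?_) (fun s => sum_adj_weight_le G hΔ hω s)
  obtain ⟨x, y, σ⟩ := b
  have h := norm_expect_bondOp_le_weighted hb σ hω φ
  simp only [ite_mul, zero_mul] at h ⊢
  exact h

end Hopping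

/-! ### The Hamiltonian: hole counting bounds the sector floors from below -/

section Hamiltonian

variable (G : SimpleGraph Λ) [DecidableRel G.Adj]

/-- The interaction energy in the occupation basis: `Re⟨φ, Σ_x n_{x↑}n_{x↓} φ⟩ = Σ_s #dbl(s) |φ(s)|²`.
[cite: Tasaki2020, §9.3] -/
theorem re_expect_interaction_eq_sum (φ : Fock (Orb Λ)) :
    (star φ ⬝ᵥ ((∑ x : Λ, numberOp x 0 * numberOp x 1) *ᵥ φ)).re =
      ∑ s, ((doublyOccupied s).card : ℝ) * ‖φ s‖ ^ 2 := by
  rw [sum_numberOp_mul_numberOp_eq_diagonal]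
  simp only [mulVec_diagonal, dotProduct, Pi.star_apply, Complex.re_sum]
  refine Finset.sum_congr rfl fun s _ => ?_
  have h : star (φ s) * (((doublyOccupied s).card : ℂ) * φ s) =
      ((((doublyOccupied s).card : ℝ) * ‖φ s‖ ^ 2 : ℝ) : ℂ) := by
    rw [Complex.star_def, mul_left_comm, Complex.conj_mul']
    push_cast
    ring
  rw [h, Complex.ofReal_re]

omit [LinearOrder Λ] in
/-- A unit Fock vector has `Σ_s |φ(s)|² = 1`. [folklore] -/
theorem sum_norm_sq_eq_one_of_unit {φ : Fock (Orb Λ)} (hφ : star φ ⬝ᵥ φ = 1) :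
    ∑ s, ‖φ s‖ ^ 2 = 1 := by
  have h : (star φ ⬝ᵥ φ).re = ∑ s, ‖φ s‖ ^ 2 := by
    simp only [dotProduct, Pi.star_apply, Complex.re_sum]
    refine Finset.sum_congr rfl fun s _ => ?_
    rw [Complex.star_def, Complex.conj_mul', ← Complex.ofReal_pow, Complex.ofReal_re]
  rw [← h, hφ, Complex.one_re]

omit [LinearOrder Λ] in
/-- On the `N`-particle sector, `Σ_s |φ(s)|² |s| = N Σ_s |φ(s)|²`. [folklore] -/
theorem sum_norm_sq_mul_card_of_isNParticle {N : ℕ} {φ : Fock (Orb Λ)} (hN : IsNParticle N φ) :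
    ∑ s, ‖φ s‖ ^ 2 * (s.card : ℝ) = N * ∑ s, ‖φ s‖ ^ 2 := by
  rw [Finset.mul_sum]
  refine Finset.sum_congr rfl fun s _ => ?_
  by_cases hs : s.card = N
  · rw [hs, mul_comm]
  · rw [hN s hs]
    simp

/-- **Hole counting bounds the Hubbard energy from below.** On a finite graph of maximal degree `≤ Δ`,
for every unit vector `φ` of the `N`-particle sector and every `ω > 0`:
`Re⟨φ, H φ⟩ ≥ -|t|Δ(|Λ| - N + ω|Λ|) + (U - |t|Δ(2 + 2ω⁻¹)) Re⟨φ, Σ_x n_{x↑}n_{x↓} φ⟩`.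
The kinetic energy available to `N` electrons is at most `|t|Δ` per HOLE, plus `|t|Δ(2 + 2ω⁻¹)` per
doublon and a density `ω|t|Δ` for the virtual doublon–hole fluctuations of the singly occupied
background. [folklore] -/
theorem holeCounting_le_re_expect_hamiltonian {Δ : ℕ}
    (hΔ : ∀ v : Λ, (Finset.univ.filter (G.Adj v)).card ≤ Δ) (t U : ℝ) {ω : ℝ} (hω : 0 < ω)
    {N : ℕ} {φ : Fock (Orb Λ)} (hN : IsNParticle N φ) (hφ : star φ ⬝ᵥ φ = 1) :
    -(|t| * Δ * ((Fintype.card Λ : ℝ) - N + ω * Fintype.card Λ)) +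
        (U - |t| * Δ * (2 + 2 * ω⁻¹)) *
          (star φ ⬝ᵥ ((∑ x : Λ, numberOp x 0 * numberOp x 1) *ᵥ φ)).re ≤
      (star φ ⬝ᵥ (hamiltonian G t U *ᵥ φ)).re := by
  have hH : hamiltonian G t U =
      -(t : ℂ) • hoppingForm G (fun _ _ => 1) + (U : ℂ) • ∑ x : Λ, numberOp x 0 * numberOp x 1 := by
    rw [hamiltonian, ← hoppingForm_one]
  set zT : ℂ := star φ ⬝ᵥ (hoppingForm G (fun _ _ => 1) *ᵥ φ) with hzT
  set D : ℝ := (star φ ⬝ᵥ ((∑ x : Λ, numberOp x 0 * numberOp x 1) *ᵥ φ)).re with hDdef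
  have hform : (star φ ⬝ᵥ (hamiltonian G t U *ᵥ φ)).re = -t * zT.re + U * D := by
    rw [hH, add_mulVec, smul_mulVec, smul_mulVec, dotProduct_add, dotProduct_smul,
      dotProduct_smul, Complex.add_re, smul_eq_mul, smul_eq_mul, ← Complex.ofReal_neg,
      Complex.re_ofReal_mul, Complex.re_ofReal_mul]
  -- the kinetic bound
  have hT := norm_expect_hoppingForm_le G hΔ hω φ
  have hDsum : D = ∑ s, ((doublyOccupied s).card : ℝ) * ‖φ s‖ ^ 2 := re_expect_interaction_eq_sum φ
  have h1 := sum_norm_sq_eq_one_of_unit hφ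
  have hNsum := sum_norm_sq_mul_card_of_isNParticle hN
  rw [h1, mul_one] at hNsum
  have hexpand : ∑ s, ‖φ s‖ ^ 2 * (Δ * ((Fintype.card Λ : ℝ) - s.card + (doublyOccupied s).card) +
        (1 + 2 * ω⁻¹) * Δ * (doublyOccupied s).card + ω * Δ * Fintype.card Λ) =
      Δ * ((Fintype.card Λ : ℝ) - N + ω * Fintype.card Λ) + Δ * (2 + 2 * ω⁻¹) * D := by
    have hterm : ∀ s : Finset (Orb Λ),
        ‖φ s‖ ^ 2 * (Δ * ((Fintype.card Λ : ℝ) - s.card + (doublyOccupied s).card) +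
          (1 + 2 * ω⁻¹) * Δ * (doublyOccupied s).card + ω * Δ * Fintype.card Λ) =
        (Δ * (Fintype.card Λ : ℝ) + ω * Δ * Fintype.card Λ) * ‖φ s‖ ^ 2 -
          Δ * (‖φ s‖ ^ 2 * (s.card : ℝ)) +
          Δ * (2 + 2 * ω⁻¹) * (((doublyOccupied s).card : ℝ) * ‖φ s‖ ^ 2) := by
      intro s; ring
    rw [Finset.sum_congr rfl fun s _ => hterm s, Finset.sum_add_distrib, Finset.sum_sub_distrib,
      ← Finset.mul_sum, ← Finset.mul_sum, ← Finset.mul_sum, h1, hNsum, ← hDsum]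
    ring
  rw [hexpand] at hT
  -- `-t Re z ≥ -|t| ‖z‖`
  have hre : -(|t| * ‖zT‖) ≤ -t * zT.re := by
    have h2 : |(-t) * zT.re| ≤ |t| * ‖zT‖ := by
      rw [abs_mul, abs_neg]
      exact mul_le_mul_of_nonneg_left (Complex.abs_re_le_norm zT) (abs_nonneg t)
    have h3 := neg_abs_le ((-t) * zT.re)
    linarith
  have h4 := mul_le_mul_of_nonneg_left hT (abs_nonneg t)
  rw [hform]
  nlinarith [h4, hre]

/-- **Strong-coupling sector floor (Nagaoka–Brinkman–Rice counting).** On a finite graph of maximal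
degree `≤ Δ`, for `ω > 0` and `U ≥ |t|Δ(2 + 2ω⁻¹)`, every nonempty joint sector `(N, S^z = M)` has
`minEnergyOn H (szSector N M) ≥ -|t|Δ(|Λ| - N + ω|Λ|)`: per site, the ground-state energy is at least
`-|t|Δ·(hole density) - ω|t|Δ`, `ω = 2|t|Δ/(U - 2|t|Δ)`. [folklore] -/
theorem holeCounting_le_minEnergyOn_szSector {Δ : ℕ}
    (hΔ : ∀ v : Λ, (Finset.univ.filter (G.Adj v)).card ≤ Δ) {t U ω : ℝ} (hω : 0 < ω)
    (hU : |t| * Δ * (2 + 2 * ω⁻¹) ≤ U) (N : ℕ) (M : ℝ)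
    (hK : ∃ ψ ∈ szSector (Λ := Λ) N M, star ψ ⬝ᵥ ψ = 1) :
    -(|t| * Δ * ((Fintype.card Λ : ℝ) - N + ω * Fintype.card Λ)) ≤
      (hamiltonian G t U).minEnergyOn (szSector N M) := by
  obtain ⟨ψ₀, hψ₀K, hψ₀⟩ := hK
  refine le_csInf ⟨_, ψ₀, hψ₀K, hψ₀, rfl⟩ ?_
  rintro E ⟨ψ, hψK, hψ1, rfl⟩
  have hN : IsNParticle N ψ := ((mem_szSector_iff N M ψ).1 hψK).1
  have h := holeCounting_le_re_expect_hamiltonian G hΔ t U hω hN hψ1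
  have hD : 0 ≤ (star ψ ⬝ᵥ ((∑ x : Λ, numberOp x 0 * numberOp x 1) *ᵥ ψ)).re := by
    rw [re_expect_interaction_eq_sum]
    positivity
  have hU' : 0 ≤ U - |t| * Δ * (2 + 2 * ω⁻¹) := sub_nonneg.2 hU
  have h5 := mul_nonneg hU' hD
  linarith

end Hamiltonian

end Literature.MathematicalPhysics.QuantumLattice
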